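import Summits.CriticalPhenomena.PercolationContinuityZ3.Theorems.SahiMasterFamilyComplementExpansion
import Summits.CriticalPhenomena.PercolationContinuityZ3.Theorems.SahiMasterFamilySparseEndExpansion
import Literature.Combinatorics.Sahi2008.PushForward

/-!
# The dense end of Sahi's hierarchy, I: reflection to the sparse end of the failure events (exact identity, all orders)

Support file of the master-family programme (crux `NoHeavyLowerTail`, stmt-CriticalPhenomena-4575; cell `prim-masterthm`, seat P4,
unit `prim-masterthm-p4-g5`).  Seat document HOME/prim-masterthm-p4/CORNERS.md §1 (Theorem D, steps (a)–(b)).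

Near `p → 1` write the intensities as `p_e = 1 − q·w_e`.  The product weight is `dpw w q ω = ∏_{e∈ω}(1 − q w_e) ∏_{e∉ω} q w_e
= spw w q ωᶜ`: the REFLECTION `ω ↦ ωᶜ` of gen 4's sparse weight.  For an increasing event `U` (`∅ ∉ U ∋ univ`) the REFLECTED FAILURE
EVENT `reflA U = {ω : ωᶜ ∉ U}` is again increasing with `∅ ∉ reflA U ∋ univ`, and `1_U(ωᶜ) = 1 − 1_{reflA U}(ω)`.  Hence
(`sahiE_dpw_eq_sahiE_spw_one_sub`) `E_k(dpw w q; 1_U) = E_k(spw w q; 1 − 1_{reflA U})`, and by the complement expansion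
(`SahiComplement.sahiE_one_sub_eq_sum`):

* **`sahiE_dpw_eq_sum`** — `E_k(dpw w q; 1_{U_0},…,1_{U_{k−1}}) = Σ_{S ⊆ [k], |S| ≥ 1} (−1)^{|S|} brCoeff(|S|, k−|S|) ·
  E_{|S|}(spw w q; (1_{reflA U_j})_{j∈S})` for every `k ≥ 2` — the dense end of `U` is an explicit signed combination of SPARSE-END
  functionals of the reflected failure events, to each of which gen 4's factorisation `q^{m_S} Ẽ_S(q)` applies.
Also `sum_spw` (`spw w p` has total mass `1` for all `w, p`).  [this work]
-/

namespace Summit.CriticalPhenomena.PercolationContinuityZ3.Theorems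

namespace SahiSparseEnd

open Finset Function SahiComplement
open Literature.Combinatorics.Sahi2008

variable {ι : Type*} [Fintype ι] [DecidableEq ι]

/-! ### Total mass of the sparse weight -/

/-- `Σ_ω spw w p ω = 1` for all `w`, `p` (`∏_e (p w_e + (1 − p w_e)) = 1`). [this work] -/
theorem sum_spw (w : ι → ℝ) (p : ℝ) : ∑ ω, spw w p ω = 1 := by
  have h := prod_add (fun e => p * w e) (fun e => 1 - p * w e) (univ : Finset ι)
  simp only [add_sub_cancel, prod_const_one] at h
  rw [h, ← powerset_univ]
  rfl

/-! ### The dense weight and the reflection -/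

/-- The DENSE product weight with intensities `1 − q·w_e`: `dpw w q ω = spw w q ωᶜ`. [this work] -/
noncomputable def dpw (w : ι → ℝ) (q : ℝ) (ω : Finset ι) : ℝ := spw w q ωᶜ

/-- `dpw w q ω = ∏_{e∈ω} (1 − q w_e) · ∏_{e∉ω} (q w_e)` — the product weight with `p_e = 1 − q w_e`. [this work] -/
theorem dpw_eq (w : ι → ℝ) (q : ℝ) (ω : Finset ι) :
    dpw w q ω = (∏ e ∈ ω, (1 - q * w e)) * ∏ e ∈ univ \ ω, (q * w e) := by
  rw [dpw, spw, compl_eq_univ_sdiff, sdiff_sdiff_right_self, inf_eq_inter, univ_inter, mul_comm]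

/-- Complementation as a permutation of the configurations. [folklore] -/
def complPerm (ι : Type*) [Fintype ι] [DecidableEq ι] : Equiv.Perm (Finset ι) :=
  Function.Involutive.toPerm compl compl_compl

/-- The dense weight is the push-forward of the sparse weight under complementation. [this work] -/
theorem dpw_eq_pushWeight (w : ι → ℝ) (q : ℝ) : dpw w q = pushWeight (spw w q) (complPerm ι) := by
  funext ω
  rw [pushWeight_equiv]
  rfl

/-- **Reflection**: `E_n(dpw w q; f) = E_n(spw w q; f ∘ compl)`. [this work] -/
theorem sahiE_dpw (w : ι → ℝ) (q : ℝ) (n : ℕ) (f : Fin n → Finset ι → ℝ) :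
    sahiE (dpw w q) n f = sahiE (spw w q) n (fun i => f i ∘ compl) := by
  rw [dpw_eq_pushWeight, sahiE_pushWeight]
  rfl

/-! ### The reflected failure events -/

/-- The REFLECTED FAILURE EVENT of `U`: `ω ∈ reflA U ↔ ωᶜ ∉ U`. [this work] -/
def reflA (U : Finset (Finset ι)) : Finset (Finset ι) := univ.filter fun ω => ωᶜ ∉ U

/-- Membership in `reflA`. [this work] -/
theorem mem_reflA {U : Finset (Finset ι)} {ω : Finset ι} : ω ∈ reflA U ↔ ωᶜ ∉ U := by simp [reflA]

/-- `reflA U` is increasing when `U` is. [this work] -/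
theorem reflA_up {U : Finset (Finset ι)} (hU : ∀ a a', a ∈ U → a ⊆ a' → a' ∈ U) (a a' : Finset ι) (ha : a ∈ reflA U)
    (haa' : a ⊆ a') : a' ∈ reflA U :=
  mem_reflA.2 fun h => mem_reflA.1 ha (hU _ _ h (compl_subset_compl.2 haa'))

/-- `∅ ∉ reflA U` iff `univ ∈ U`. [this work] -/
theorem empty_not_mem_reflA {U : Finset (Finset ι)} (h : (univ : Finset ι) ∈ U) : ∅ ∉ reflA U := fun h' =>
  mem_reflA.1 h' (by rwa [compl_empty])

/-- `univ ∈ reflA U` iff `∅ ∉ U`. [this work] -/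
theorem univ_mem_reflA {U : Finset (Finset ι)} (h : ∅ ∉ U) : (univ : Finset ι) ∈ reflA U :=
  mem_reflA.2 (by rwa [compl_univ])

/-- `1_U ∘ compl = 1 − 1_{reflA U}`. [this work] -/
theorem setInd_comp_compl (U : Finset (Finset ι)) : setInd U ∘ compl = (1 : Finset ι → ℝ) - setInd (reflA U) := by
  funext ω
  simp only [comp_apply, Pi.sub_apply, Pi.one_apply, setInd_apply, mem_reflA]
  split_ifs <;> norm_num

section Events

variable {k : ℕ} (U : Fin k → Finset (Finset ι))

/-- **`E_k(dpw w q; 1_U) = E_k(spw w q; 1 − 1_{reflA U})`.** [this work] -/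
theorem sahiE_dpw_eq_sahiE_spw_one_sub (w : ι → ℝ) (q : ℝ) :
    sahiE (dpw w q) k (fun i => setInd (U i)) = sahiE (spw w q) k (fun i => 1 - setInd (reflA (U i))) := by
  rw [sahiE_dpw]
  congr 1
  funext i
  rw [setInd_comp_compl]

/-- **THE DENSE END AS A SIGNED SUM OF SPARSE ENDS (exact, all orders `k ≥ 2`).**
`E_k(dpw w q; 1_{U_0},…,1_{U_{k−1}}) = Σ_{S ⊆ [k], |S| ≥ 1} (−1)^{|S|} brCoeff(|S|, k−|S|) · E_{|S|}(spw w q; (1_{reflA U_j})_{j∈S})`,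
`brCoeff(s, k−s) = (k−2)!/(s−2)!` for `s ≥ 2` and `0` for `s = 1`. [this work] -/
theorem sahiE_dpw_eq_sum (hk : 2 ≤ k) (w : ι → ℝ) (q : ℝ) :
    sahiE (dpw w q) k (fun i => setInd (U i)) = ∑ S ∈ ((univ : Finset (Fin k)).powerset).filter (fun S => 1 ≤ S.card),
      (-1 : ℝ) ^ S.card * (brCoeff S.card (k - S.card) *
        sahiE (spw w q) S.card (fun j => setInd (reflA (U (S.orderEmbOfFin rfl j))))) := by
  rw [sahiE_dpw_eq_sahiE_spw_one_sub, sahiE_one_sub_eq_sum (sum_spw w q) hk]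

end Events

end SahiSparseEnd

end Summit.CriticalPhenomena.PercolationContinuityZ3.Theorems
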